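/-
Copyright (c) 2026 the pub-hodgecm-mathlib formalisation cell (harness21).  Prover seat hodgecm-mathlib-A-p12 (g25): road «S3-ram» (LEAD F0P3a-plan (g13); (Cnt2′) chair
F0P3a-p07 (g15) RULING (13) organ (4b); (α) keeper F0P3a-p06 (g16)); organ (K1) of the (4b) decomposition; 2026-09-02.
-/
import Literature.NumberTheory.Automorphic.UnitaryLatticeTreeAxisPropagationRamified    -- ★ (F0P3-p03): eigenline propagation at every odd level; brings ★ `…EigenlinePropagationRamified` (pivot, odd-level congruences), ★ `…FixedChildSameLevelRamified` (`…iff_lower`), ★ O-LBL, ★ H, ★ L, ★ F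
import HarnessLib

/-!
# The lattice graph of a hermitian space — OFF-REGION GRANDCHILD LABELS AND THE SAME-LEVEL CRITERION AT A REGION VERTEX OF ODD LEVEL, FOR ANY UNITARY LITERAL
# (tame-ramified place; Kottwitz 1986 §3; Rogawski 1990 §4.9; Bruhat–Tits 1972 §10; Tits 1979 §3.5)

Topic `NumberTheory/Automorphic`; namespace `Literature.NumberTheory.Automorphic.UnitaryLatticeTree`.  THEOREMS ONLY (no definition, no instance, no notation, no named fact,
no `sorry`); kernel lane `--supports stmt-HodgeConjecture-24833`; datum-free (`K` with `Valued K ℤᵐ⁰`, `σ` an involution with `σϖ = −ϖ`).  Cell `pub/hodgecm-mathlib`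
(D-0151), crux H413; road «S3-ram» (Literature seeding, count-neutral); (Cnt2′) ROUTE B, chair RULING (13) organ **(4b) «PER-KIND VALUES over the W-ball»** (A-p12 (g25)),
sub-organ **(K1)** of the decomposition posted 2026-09-02T04:2xZ: the GENERIC ODD-LEVEL GRANDCHILD LAW — ★ S2 `offRegionGrandchildLabels` (F0P3a-p04 (g19),
`UnitaryLatticeTreeOffRegionGrandchildLabelsRamified`) with its isoceles eigen-data `(d, A, s, i₀, hiso, hclose)` REPLACED by the one consequence its proof uses, `Odd d₀`
(S2 derives `Odd d₀` from the norm-one eigenvalues and never touches the eigenframe again) — so that the TYPE-(2) literals `ι(B₀, 1)` (hyperbolic, A-p12) and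
`P₁·ι(γ₁, 1)·P₁⁻¹` (anisotropic, A-p16 (g33) ∕ F0P3a-p08 (g20)), whose root depth `d₀ = 2mA + 3` is odd by the (α) skeleton's dictionary, read their region-vertex census
through the same law; plus the SAME-LEVEL CRITERION through a child at odd level, digit-uniform.

THE MATHEMATICS.  `γ ∈ U(σ, J₀)` (`J₀ = antidiag(1,1,1)`), a region vertex `v = u·r₀` (`u ∈ U(σ,J₀)`; `(γ−1)·v ⊆ ϖ^{d₀}·v`, `d₀ ≥ 3` ODD), a child `(uκ)·N₁` (`κ ∈ K₀`,
`N₁ = latt diag(1,1,ϖ)`), `M := κ⁻¹(u⁻¹(γ−1)u)κ` (level `ϖ^{d₀}`), a far vertex `w = latt((uκ)·g(a,b))` through the child (`|a| = 1`, `|b| ≤ 1`; `w ≠ v`).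
* §1 **`map_sub_one_childLatt_le_scaleLattice_iff_eigenline_of_odd`** (frame currency `κ γ : U(σ,J₀)`, `M = κ⁻¹(γ−1)κ` of odd level `d ≥ 1`): **`(γ−1)·latt(κ·g(a,b)) ⊆
  ϖ^d·latt(κ·g(a,b)) ⟺ |M₁₀| ≤ |ϖ|^{d+1} ∧ |M₂₀| ≤ |ϖ|^{d+1}`** — the far vertex keeps the level iff the line `κe₀` is a FIRST-ORDER EIGENLINE of `Ȳ = ϖ^{−d}M mod ϖ`,
  for EVERY digit `(a, b)`: «⇐» is ★ eigenline propagation `map_sub_one_childLatt_le_scaleLattice_of_eigenline_of_odd_level`; «⇒» is ★ `…_iff_lower` (`|M₁₀| ≤ |ϖ|^{d+1}`,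
  `|a·M₂₀ + ϖb(M₂₂ − M₀₀)| ≤ |ϖ|^{d+2}`) with the odd-level congruence ★ `M₂₂ ≡ M₀₀ (ϖ^{d+1})`.  So the grandchildren through a child lie in the region or off it in FULL digit
  fibres, decided by the two residues `M̄₁₀, M̄₂₀` of the child's line.
* §2 **`offRegionGrandchildLabels_of_odd`** = ★ S2 verbatim with `(hodd : Odd d₀)` in place of the eigen-data (and the unused `_`-binders of the socket dropped): for `w` OFF the
  region, a NULL line value `t = ϖ^{−d₀}·B₀(κe₀, (u⁻¹γu − 1)κe₀)` gives the E-label `LEV(ϖ^{d₀−1}) ∧ ¬LEV(ϖ^{d₀}) ∧ ¬LEV₂(ϖ^{2d₀−1})`, a UNIT value of class `t` gives the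
  P-label `LEV(ϖ^{d₀−2}) ∧ ¬LEV(ϖ^{d₀−1}) ∧ LEV₂(ϖ^{2d₀−3}) ∧ CLS(d₀−2)(−t)`.
* §3 **`map_sub_one_far_le_scaleLattice_iff_eigenline_of_odd`**: §1 in the child currency of §2 (`v = u·r₀` a region vertex, `w` adjacent to `(uκ)·N₁`, `w ≠ v`):
  `LEV[w](ϖ^{d₀}) ⟺ |M₁₀| ≤ |ϖ|^{d₀+1} ∧ |M₂₀| ≤ |ϖ|^{d₀+1}` for `M = (uκ)⁻¹(γ−1)(uκ)`.
Consumers: (K2) the odd-level token slices (`#{w ∈ GC(v) ∣ off-region ∧ E∕P∕M} = q·#{children ∣ ¬eigenline ∧ null ∕ class}`), (K4) the hyperbolic per-kind values, and the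
anisotropic `stub_Zaniso_*` root census.
HONEST LABEL: HC_CM is proved only modulo the 2 remaining named inputs (hLiu418 24832, h413 24833) until rung 0 closes; nothing printed is asserted here (elementary algebra
over a valuation ring); «S3-ram» has no books consequence.

## References
* [Kottwitz1986] R. E. Kottwitz, *Base change for unit elements of Hecke algebras*, Compositio Math. 60 (1986), §3 (levels of fixed lattices; shell recursion).
* [Rogawski1990] J. D. Rogawski, *Automorphic Representations of Unitary Groups in Three Variables*, Ann. of Math. Stud. 123 (1990), §4.9 pp. 54–56.
* [BruhatTits1972] F. Bruhat, J. Tits, *Groupes réductifs sur un corps local I*, Publ. Math. IHÉS 41 (1972), §10 (lattice models; vertex stabilisers and their filtrations).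
* [Tits1979] J. Tits, *Reductive groups over local fields*, PSPM 33.1 (1979), §3.5 (congruence filtration; reduction mod `𝔭`).
* [Serre1980Trees] J.-P. Serre, *Trees* (1980), Ch. II §1.1–1.2 (lattices, neighbours, levels).
-/

set_option autoImplicit false

noncomputable section

open scoped Valued WithZero Matrix MatrixGroups

namespace Literature.NumberTheory.Automorphic.UnitaryLatticeTree

open Literature.NumberTheory.Automorphic Literature.NumberTheory.Automorphic.HermitianLattice

variable {K : Type*} [Field K] [Valued K ℤᵐ⁰] {σ : K →+* K} {ϖ : K}

/-! ## §1 The same-level criterion through a child at odd level: first-order eigenline, digit-uniform -/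

/-- **SAME LEVEL THROUGH A CHILD ⟺ FIRST-ORDER EIGENLINE (odd level).**  `κ, γ ∈ U(σ, J₀)`, `M = κ⁻¹(γ−1)κ` of ODD level `ϖ^d` (`d ≥ 1`; ramified place, `|2| = 1`);
then for EVERY neighbour `Λ′ = latt(κ·g(a,b))` through the line `x̄ = κe₀` (`|a| = 1`, `|b| ≤ 1`): **`(γ−1)·Λ′ ⊆ ϖ^d·Λ′ ⟺ |M₁₀| ≤ |ϖ|^{d+1} ∧ |M₂₀| ≤ |ϖ|^{d+1}`**.
«⇐»: ★ `map_sub_one_childLatt_le_scaleLattice_of_eigenline_of_odd_level`.  «⇒»: ★ `map_sub_one_childLatt_le_scaleLattice_iff_lower` gives `|M₁₀| ≤ |ϖ|^{d+1}` and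
`|a·M₂₀ + ϖ·b·(M₂₂ − M₀₀)| ≤ |ϖ|^{d+2}`; with ★ `M₂₂ ≡ M₀₀ (ϖ^{d+1})` (odd level) the second summand is `≤ |ϖ|^{d+2}`, hence `|M₂₀| ≤ |ϖ|^{d+2} ≤ |ϖ|^{d+1}`.
[cite: Kottwitz1986, §3] [cite: BruhatTits1972, §10] [cite: Tits1979, §3.5] -/
theorem map_sub_one_childLatt_le_scaleLattice_iff_eigenline_of_odd (hvσ : ∀ z, Valued.v (σ z) = Valued.v z) (hσϖ : σ ϖ = -ϖ)
    (hϖ : Valued.v ϖ = WithZero.exp (-1 : ℤ)) (hres : ∀ x : K, Valued.v x ≤ 1 → Valued.v (σ x - x) < 1) (h2 : Valued.v (2 : K) = 1)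
    (κ γ : unitaryGroupOfForm σ ((StdForm.antidiagonal 3).over K)) {a b : K} (ha : Valued.v a = 1) (hb : Valued.v b ≤ 1) {d : ℕ} (hodd : Odd d)
    (hM : ∀ i j, Valued.v (((((κ : GL (Fin 3) K)⁻¹ : GL (Fin 3) K) : Matrix (Fin 3) (Fin 3) K) * (((γ : GL (Fin 3) K) : Matrix (Fin 3) (Fin 3) K) - 1) *
      ((κ : GL (Fin 3) K) : Matrix (Fin 3) (Fin 3) K)) i j) ≤ Valued.v ϖ ^ d) :
    (latt (((κ : GL (Fin 3) K) : Matrix (Fin 3) (Fin 3) K) * !![a / ϖ, 0, 0; 0, 1, 0; b, 0, ϖ])).map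
        ((Matrix.toLin' (((γ : GL (Fin 3) K) : Matrix (Fin 3) (Fin 3) K) - 1)).restrictScalars 𝒪[K]) ≤
      scaleLattice (ϖ ^ d) (latt (((κ : GL (Fin 3) K) : Matrix (Fin 3) (Fin 3) K) * !![a / ϖ, 0, 0; 0, 1, 0; b, 0, ϖ])) ↔
    Valued.v (((((κ : GL (Fin 3) K)⁻¹ : GL (Fin 3) K) : Matrix (Fin 3) (Fin 3) K) * (((γ : GL (Fin 3) K) : Matrix (Fin 3) (Fin 3) K) - 1) *
      ((κ : GL (Fin 3) K) : Matrix (Fin 3) (Fin 3) K)) 1 0) ≤ Valued.v ϖ ^ (d + 1) ∧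
    Valued.v (((((κ : GL (Fin 3) K)⁻¹ : GL (Fin 3) K) : Matrix (Fin 3) (Fin 3) K) * (((γ : GL (Fin 3) K) : Matrix (Fin 3) (Fin 3) K) - 1) *
      ((κ : GL (Fin 3) K) : Matrix (Fin 3) (Fin 3) K)) 2 0) ≤ Valued.v ϖ ^ (d + 1) := by
  have hϖ1 : Valued.v ϖ ≤ 1 := by rw [hϖ, ← WithZero.exp_zero]; exact WithZero.exp_le_exp.2 (by norm_num)
  have ha0 : Valued.v a ≠ 0 := by rw [ha]; exact one_ne_zero
  set M : Matrix (Fin 3) (Fin 3) K := (((κ : GL (Fin 3) K)⁻¹ : GL (Fin 3) K) : Matrix (Fin 3) (Fin 3) K) * (((γ : GL (Fin 3) K) : Matrix (Fin 3) (Fin 3) K) - 1) *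
      ((κ : GL (Fin 3) K) : Matrix (Fin 3) (Fin 3) K) with hMdef
  constructor
  · intro hlev
    obtain ⟨h10, -, hmix⟩ := (map_sub_one_childLatt_le_scaleLattice_iff_lower hϖ (κ : GL (Fin 3) K) (γ : GL (Fin 3) K) ha hb hM).1 hlev
    refine ⟨h10, ?_⟩
    -- `M₂₂ ≡ M₀₀ (ϖ^{d+1})` for the unitary `κ⁻¹γκ` at odd level
    have hY : ∀ i j, Valued.v (((((κ⁻¹ * γ * κ : unitaryGroupOfForm σ ((StdForm.antidiagonal 3).over K)) : GL (Fin 3) K) : Matrix (Fin 3) (Fin 3) K) - 1) i j) ≤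
        Valued.v ϖ ^ d := by
      intro i j; rw [coe_inv_mul_mul_sub_one]; exact hM i j
    have h2200 := v_coe_sub_one_two_two_sub_zero_zero_le_of_odd hvσ hσϖ hϖ hres (κ⁻¹ * γ * κ) hodd.pos hodd hY
    rw [coe_inv_mul_mul_sub_one] at h2200
    have hsec : Valued.v (ϖ * b * (M 2 2 - M 0 0)) ≤ Valued.v ϖ ^ (d + 2) := by
      rw [map_mul, map_mul]
      calc Valued.v ϖ * Valued.v b * Valued.v (M 2 2 - M 0 0) ≤ Valued.v ϖ * 1 * Valued.v ϖ ^ (d + 1) := mul_le_mul' (mul_le_mul' le_rfl hb) h2200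
        _ = Valued.v ϖ ^ (d + 2) := by rw [mul_one, ← pow_succ']
    have haM : Valued.v (a * M 2 0) ≤ Valued.v ϖ ^ (d + 2) := by
      have e : a * M 2 0 = (a * M 2 0 + ϖ * b * (M 2 2 - M 0 0)) - ϖ * b * (M 2 2 - M 0 0) := by ring
      rw [e]
      exact (Valuation.map_sub _ _ _).trans (max_le hmix hsec)
    rw [map_mul, ha, one_mul] at haM
    exact haM.trans (pow_le_pow_right_of_le_one' hϖ1 (by omega))
  · rintro ⟨h10, h20⟩
    exact map_sub_one_childLatt_le_scaleLattice_of_eigenline_of_odd_level hvσ hσϖ hϖ hres h2 κ γ ha hb hodd hM h10 h20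

/-! ## §2 The labels of the off-region grandchildren of a region vertex at odd level (★ S2, eigenframe-free) -/

/-- **OFF-REGION GRANDCHILD LABELS AT A REGION VERTEX OF ODD LEVEL, ANY UNITARY LITERAL** — ★ S2 `offRegionGrandchildLabels` (F0P3a-p04 (g19)) with the isoceles
eigen-data replaced by `Odd d₀` (all its proof used them for) and the socket's unused binders dropped.  `γ ∈ U(σ, J₀)`; region vertex `v = u·r₀` (`(γ−1)·v ⊆ ϖ^{d₀}·v`,
`d₀ ≥ 3` odd); child `(uκ)·N₁` (`κ ∈ K₀`) keyed by its depth-`d₀` line value `t = (ϖ^d₀)⁻¹·B₀(κe₀, (u⁻¹γu − 1)κe₀)`; a far vertex `w ≠ v` through it OUTSIDE the region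
(`¬LEV[w](ϖ^d₀)`) has the E-label `LEV(ϖ^{d₀−1}) ∧ ¬LEV(ϖ^{d₀}) ∧ ¬LEV₂(ϖ^{2d₀−1})` if `t` is NULL and the P-label `LEV(ϖ^{d₀−2}) ∧ ¬LEV(ϖ^{d₀−1}) ∧ LEV₂(ϖ^{2d₀−3}) ∧
CLS(d₀−2)(−t)` if `t` is a UNIT.  NULL ⇒ pivot by ★ eigenline propagation at the odd level `d₀`, UNIT ⇒ ★ O-LBL + ★ H class token.
[cite: Kottwitz1986, §3] [cite: Rogawski1990, §4.9 pp. 54–56] [cite: BruhatTits1972, §10] [cite: Tits1979, §3.5] -/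
theorem offRegionGrandchildLabels_of_odd (hvσ : ∀ a, Valued.v (σ a) = Valued.v a) (hσϖ : σ ϖ = -ϖ)
    (hϖ : Valued.v ϖ = WithZero.exp (-1 : ℤ)) (hres : ∀ x : K, Valued.v x ≤ 1 → Valued.v (σ x - x) < 1) (h2 : Valued.v (2 : K) = 1) [Finite 𝓀[K]]
    {γ : unitaryGroupOfForm σ ((StdForm.antidiagonal 3).over K)}
    {d₀ : ℕ} (hd3 : 3 ≤ d₀) (hodd : Odd d₀)
    (u : unitaryGroupOfForm σ ((StdForm.antidiagonal 3).over K)) {v : {M : Submodule 𝒪[K] (Fin 3 → K) // IsVertex σ ϖ ((StdForm.antidiagonal 3).over K) M}} (hvu : v = latticeGraphIso σ ϖ ((StdForm.antidiagonal 3).over K) u ⟨stdLattice K 3, 0, isSelfDualLattice_stdLattice_three_of_v hϖ⟩)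
    (hvR : v.1.map ((Matrix.toLin' (((γ : GL (Fin 3) K) : Matrix (Fin 3) (Fin 3) K) - 1)).restrictScalars 𝒪[K]) ≤ scaleLattice (ϖ ^ d₀) v.1)
    (κ : unitaryGroupOfForm σ ((StdForm.antidiagonal 3).over K)) (hκ : κ ∈ unitaryInt σ ((StdForm.antidiagonal 3).over K))
    {w : {M : Submodule 𝒪[K] (Fin 3 → K) // IsVertex σ ϖ ((StdForm.antidiagonal 3).over K) M}} (hwv : w ≠ v)
    (hcw : (latticeGraph σ ϖ ((StdForm.antidiagonal 3).over K)).Adj (latticeGraphIso σ ϖ ((StdForm.antidiagonal 3).over K) (u * κ) ⟨latt (Matrix.diagonal ![(1 : K), 1, ϖ]), 2, isVertexLattice_two_N₁_of_neg hσϖ hϖ⟩) w)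
    (hwR : ¬ w.1.map ((Matrix.toLin' (((γ : GL (Fin 3) K) : Matrix (Fin 3) (Fin 3) K) - 1)).restrictScalars 𝒪[K]) ≤ scaleLattice (ϖ ^ d₀) w.1) :
    (Valued.v ((ϖ ^ d₀)⁻¹ * pairing σ ((StdForm.antidiagonal 3).over K) (((κ : GL (Fin 3) K) : Matrix (Fin 3) (Fin 3) K) *ᵥ Pi.single 0 1) (((((u⁻¹ * γ * u : unitaryGroupOfForm σ ((StdForm.antidiagonal 3).over K)) : GL (Fin 3) K) : Matrix (Fin 3) (Fin 3) K) - 1) *ᵥ (((κ : GL (Fin 3) K) : Matrix (Fin 3) (Fin 3) K) *ᵥ Pi.single 0 1))) < 1 →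
        w.1.map ((Matrix.toLin' (((γ : GL (Fin 3) K) : Matrix (Fin 3) (Fin 3) K) - 1)).restrictScalars 𝒪[K]) ≤ scaleLattice (ϖ ^ (d₀ - 1)) w.1 ∧ ¬ w.1.map ((Matrix.toLin' (((γ : GL (Fin 3) K) : Matrix (Fin 3) (Fin 3) K) - 1)).restrictScalars 𝒪[K]) ≤ scaleLattice (ϖ ^ d₀) w.1 ∧ ¬ w.1.map ((Matrix.toLin' ((((γ : GL (Fin 3) K) : Matrix (Fin 3) (Fin 3) K) - 1) ^ 2)).restrictScalars 𝒪[K]) ≤ scaleLattice (ϖ ^ (2 * d₀ - 1)) w.1) ∧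
      (∀ t : K, Valued.v t = 1 → Valued.v (((ϖ ^ d₀)⁻¹ * pairing σ ((StdForm.antidiagonal 3).over K) (((κ : GL (Fin 3) K) : Matrix (Fin 3) (Fin 3) K) *ᵥ Pi.single 0 1) (((((u⁻¹ * γ * u : unitaryGroupOfForm σ ((StdForm.antidiagonal 3).over K)) : GL (Fin 3) K) : Matrix (Fin 3) (Fin 3) K) - 1) *ᵥ (((κ : GL (Fin 3) K) : Matrix (Fin 3) (Fin 3) K) *ᵥ Pi.single 0 1))) - t) < 1 →
        w.1.map ((Matrix.toLin' (((γ : GL (Fin 3) K) : Matrix (Fin 3) (Fin 3) K) - 1)).restrictScalars 𝒪[K]) ≤ scaleLattice (ϖ ^ (d₀ - 2)) w.1 ∧ ¬ w.1.map ((Matrix.toLin' (((γ : GL (Fin 3) K) : Matrix (Fin 3) (Fin 3) K) - 1)).restrictScalars 𝒪[K]) ≤ scaleLattice (ϖ ^ (d₀ - 1)) w.1 ∧ w.1.map ((Matrix.toLin' ((((γ : GL (Fin 3) K) : Matrix (Fin 3) (Fin 3) K) - 1) ^ 2)).restrictScalars 𝒪[K]) ≤ scaleLattice (ϖ ^ (2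 * d₀ - 3)) w.1 ∧
          (∃ y ∈ w.1, ∃ a : K, Valued.v a = 1 ∧ Valued.v ((ϖ ^ (d₀ - 2))⁻¹ * pairing σ ((StdForm.antidiagonal 3).over K) y ((((γ : GL (Fin 3) K) : Matrix (Fin 3) (Fin 3) K) - 1) *ᵥ y) - (-t) * a ^ 2) < 1)) := by
  have hϖ0 : ϖ ≠ 0 := fun h0 => by rw [h0, map_zero] at hϖ; exact WithZero.coe_ne_zero hϖ.symm
  have hvϖ0 : Valued.v ϖ ≠ 0 := (Valuation.ne_zero_iff _).2 hϖ0
  have hϖlt : Valued.v ϖ < 1 := by rw [hϖ, ← WithZero.exp_zero]; exact WithZero.exp_lt_exp.2 (by norm_num)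
  have hd1 : 1 ≤ d₀ := by omega
  have hd2 : 2 ≤ d₀ := by omega
  -- STEP A — the frame of the grandchild: `w = latt((uκ)·g(a,b))`, `|a| = 1`, `|b| ≤ 1` (★ D pulled back along `uκ`)
  obtain ⟨a, b, ha, hb, hw1⟩ : ∃ a b : K, Valued.v a = 1 ∧ Valued.v b ≤ 1 ∧
      w.1 = latt ((((u * κ : unitaryGroupOfForm σ ((StdForm.antidiagonal 3).over K)) : GL (Fin 3) K) : Matrix (Fin 3) (Fin 3) K) * !![a / ϖ, 0, 0; 0, 1, 0; b, 0, ϖ]) := by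
    set w' := latticeGraphIso σ ϖ ((StdForm.antidiagonal 3).over K) (u * κ)⁻¹ w with hw'def
    have hww' : latticeGraphIso σ ϖ ((StdForm.antidiagonal 3).over K) (u * κ) w' = w := latticeGraphIso_mul_inv_apply _ _
    have hw' : w' ∈ (latticeGraph σ ϖ ((StdForm.antidiagonal 3).over K)).neighborSet ⟨latt (Matrix.diagonal ![(1 : K), 1, ϖ]), 2, isVertexLattice_two_N₁_of_neg hσϖ hϖ⟩ := by
      rw [SimpleGraph.mem_neighborSet]
      rw [← hww'] at hcw
      exact (latticeGraphIso σ ϖ ((StdForm.antidiagonal 3).over K) (u * κ)).map_adj_iff.1 hcw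
    have hne' : w'.1 ≠ stdLattice K 3 := by
      intro h
      apply hwv
      have hroot : w' = ⟨stdLattice K 3, 0, isSelfDualLattice_stdLattice_three_of_v hϖ⟩ := Subtype.ext h
      rw [← hww', hroot, latticeGraphIso_mul_apply, latticeGraphIso_root_eq_of_mem_unitaryInt hϖ hκ, ← hvu]
    obtain ⟨a, b, ha, hb, hw'1⟩ := exists_unit_vec_of_mem_neighborSet_N₁_of_ne_stdLattice hvσ hσϖ hϖ hres hw' hne'
    refine ⟨a, b, ha, hb, ?_⟩
    rw [← hww', latticeGraphIso_apply_val, hw'1, latt_coe_mul_childFrame_eq hϖ _ ha hb]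
  -- STEP B — the element in the frame: `M = (uκ)⁻¹(γ−1)(uκ) = κ⁻¹·(u⁻¹(γ−1)u)·κ`, of level `ϖ^{d₀}` because `v = latt u` is a region vertex and `κ ∈ K₀`
  set M : Matrix (Fin 3) (Fin 3) K := ((((u * κ : unitaryGroupOfForm σ ((StdForm.antidiagonal 3).over K)) : GL (Fin 3) K)⁻¹ : GL (Fin 3) K) : Matrix (Fin 3) (Fin 3) K) *
      (((γ : GL (Fin 3) K) : Matrix (Fin 3) (Fin 3) K) - 1) * (((u * κ : unitaryGroupOfForm σ ((StdForm.antidiagonal 3).over K)) : GL (Fin 3) K) : Matrix (Fin 3) (Fin 3) K)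
    with hMdef
  have hMeq : M = (((κ : GL (Fin 3) K)⁻¹ : GL (Fin 3) K) : Matrix (Fin 3) (Fin 3) K) *
      ((((u : GL (Fin 3) K)⁻¹ : GL (Fin 3) K) : Matrix (Fin 3) (Fin 3) K) * (((γ : GL (Fin 3) K) : Matrix (Fin 3) (Fin 3) K) - 1) * ((u : GL (Fin 3) K) : Matrix (Fin 3) (Fin 3) K)) *
      ((κ : GL (Fin 3) K) : Matrix (Fin 3) (Fin 3) K) := by
    rw [hMdef, Subgroup.coe_mul, mul_inv_rev, Units.val_mul, Units.val_mul]
    simp only [Matrix.mul_assoc]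
  have hv1 : v.1 = latt ((u : GL (Fin 3) K) : Matrix (Fin 3) (Fin 3) K) := by rw [hvu, latticeGraphIso_apply_val]; rfl
  have hY : ∀ i k, Valued.v (((((u : GL (Fin 3) K)⁻¹ : GL (Fin 3) K) : Matrix (Fin 3) (Fin 3) K) * (((γ : GL (Fin 3) K) : Matrix (Fin 3) (Fin 3) K) - 1) *
      ((u : GL (Fin 3) K) : Matrix (Fin 3) (Fin 3) K)) i k) ≤ Valued.v ϖ ^ d₀ := by
    have h := hvR
    rw [hv1, map_toLin'_latt_le_scaleLattice_iff (pow_ne_zero _ hϖ0) _ (Matrix.isUnits_det_units _), map_pow, ← Matrix.coe_units_inv] at h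
    exact h
  have hκi := (mem_unitaryInt_iff.1 hκ).1
  have hκi' := (mem_unitaryInt_iff.1 hκ).2
  have hM : ∀ i k, Valued.v (M i k) ≤ Valued.v ϖ ^ d₀ := by
    intro i k; rw [hMeq]; exact v_mul_mul_apply_le_of_le hκi' hY hκi i k
  -- STEP C — the corner is the value of the line
  have hcorner : pairing σ ((StdForm.antidiagonal 3).over K) (((κ : GL (Fin 3) K) : Matrix (Fin 3) (Fin 3) K) *ᵥ Pi.single 0 1)
      (((((u⁻¹ * γ * u : unitaryGroupOfForm σ ((StdForm.antidiagonal 3).over K)) : GL (Fin 3) K) : Matrix (Fin 3) (Fin 3) K) - 1) *ᵥ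
        (((κ : GL (Fin 3) K) : Matrix (Fin 3) (Fin 3) K) *ᵥ Pi.single 0 1)) = M 2 0 := by
    rw [pairing_coe_mulVec_single_eq_inv_mul_mul_apply κ, coe_inv_mul_mul_sub_one γ u, hMeq]
  have hpowne : Valued.v ϖ ^ d₀ ≠ 0 := pow_ne_zero _ hvϖ0
  have hscale : ∀ x : K, Valued.v ((ϖ ^ d₀)⁻¹ * x) = (Valued.v ϖ ^ d₀)⁻¹ * Valued.v x := fun x => by rw [map_mul, map_inv₀, map_pow]
  have hnot : ¬ (latt ((((u * κ : unitaryGroupOfForm σ ((StdForm.antidiagonal 3).over K)) : GL (Fin 3) K) : Matrix (Fin 3) (Fin 3) K) * !![a / ϖ, 0, 0; 0, 1, 0; b, 0, ϖ])).map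
        ((Matrix.toLin' (((γ : GL (Fin 3) K) : Matrix (Fin 3) (Fin 3) K) - 1)).restrictScalars 𝒪[K]) ≤
      scaleLattice (ϖ ^ d₀) (latt ((((u * κ : unitaryGroupOfForm σ ((StdForm.antidiagonal 3).over K)) : GL (Fin 3) K) : Matrix (Fin 3) (Fin 3) K) * !![a / ϖ, 0, 0; 0, 1, 0; b, 0, ϖ])) := by
    rw [← hw1]; exact hwR
  refine ⟨fun hnull => ?_, fun t ht hclose_t => ?_⟩
  · -- NULL line: the corner passes; `w` drops the level, so the line is NOT an eigenline — pivot `|M₁₀| = |ϖ|^{d₀}`, label `E = (d₀−1, rank 2)`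
    rw [hcorner, hscale] at hnull
    have h20lt : Valued.v (M 2 0) < Valued.v ϖ ^ d₀ := by
      have h' := mul_lt_mul_of_pos_left hnull (zero_lt_iff.2 hpowne)
      rwa [← mul_assoc, mul_inv_cancel₀ hpowne, one_mul, mul_one] at h'
    have h20 : Valued.v (M 2 0) ≤ Valued.v ϖ ^ (d₀ + 1) := by
      have hdm : Valued.v ϖ ^ d₀ = Valued.v ϖ ^ (d₀ + 1) * WithZero.exp (1 : ℤ) := by
        rw [pow_succ, hϖ, mul_assoc, ← WithZero.exp_add]; norm_num
      rw [hdm] at h20lt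
      exact (WithZero.lt_mul_exp_iff_le (pow_ne_zero _ hvϖ0)).1 h20lt
    have h10 : Valued.v (M 1 0) = Valued.v ϖ ^ d₀ :=
      v_one_zero_eq_of_corner_of_not_map_sub_one_childLatt_le hvσ hσϖ hϖ hres h2 (u * κ) γ ha hb hd2 hodd hM h20 hnot
    rw [hw1]
    exact ⟨(map_sub_one_childLatt_le_scaleLattice_pred_iff hϖ ((u * κ : unitaryGroupOfForm σ ((StdForm.antidiagonal 3).over K)) : GL (Fin 3) K) (γ : GL (Fin 3) K) ha hb hd1 hM).2 h20,
      hnot, fun h => ((map_sub_one_sq_childLatt_le_scaleLattice_iff_of_corner hvσ hϖ (u * κ) γ ha hb hd1 hM h20).1 h) h10⟩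
  · -- UNIT line of class `t`: the corner is a unit at order `d₀`, label `P = (d₀−2, rank ≤ 1, class −t)`
    have h20 : ¬ Valued.v (M 2 0) ≤ Valued.v ϖ ^ (d₀ + 1) := by
      intro hle
      have hsmall : Valued.v ((ϖ ^ d₀)⁻¹ * M 2 0) < 1 := by
        rw [hscale]
        calc (Valued.v ϖ ^ d₀)⁻¹ * Valued.v (M 2 0) ≤ (Valued.v ϖ ^ d₀)⁻¹ * Valued.v ϖ ^ (d₀ + 1) := mul_le_mul' le_rfl hle
          _ = Valued.v ϖ := by rw [pow_succ, ← mul_assoc, inv_mul_cancel₀ hpowne, one_mul]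
          _ < 1 := hϖlt
      rw [hcorner] at hclose_t
      have hsub : Valued.v ((ϖ ^ d₀)⁻¹ * M 2 0 - t) = Valued.v t := by
        rw [← ht] at hsmall
        exact Valuation.map_sub_eq_of_lt_right _ hsmall
      rw [hsub, ht] at hclose_t
      exact lt_irrefl _ hclose_t
    obtain ⟨hl1, hl2, hl3⟩ := childLabels_of_not_null hϖ (u * κ) γ ha hb hd2 hM h20
    rw [hw1]
    refine ⟨hl1, hl2, hl3, ?_⟩
    refine exists_mem_childLatt_class_neg_of_lineClass hvσ hσϖ hϖ hres (u * κ) γ ha hb hd2 hM ⟨1, by rw [map_one], ?_⟩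
    rw [one_pow, mul_one]
    rw [hcorner] at hclose_t
    exact hclose_t


/-! ## §3 The same-level criterion in the child currency of §2 -/

/-- **A FAR VERTEX THROUGH A CHILD KEEPS THE LEVEL ⟺ THE CHILD'S LINE IS A FIRST-ORDER EIGENLINE** (child currency of §2).  `γ ∈ U(σ, J₀)`; region vertex `v = u·r₀`
(`(γ−1)·v ⊆ ϖ^{d₀}·v`, `d₀` odd, `d₀ ≥ 1`); child `(uκ)·N₁` (`κ ∈ K₀`); `w ≠ v` adjacent to the child; `M := (uκ)⁻¹(γ−1)(uκ)`.  Then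
**`LEV[w](ϖ^{d₀}) ⟺ |M₁₀| ≤ |ϖ|^{d₀+1} ∧ |M₂₀| ≤ |ϖ|^{d₀+1}`** — independent of WHICH far vertex through the child (§1 on the frame `w = latt((uκ)·g(a,b))`, ★ D).
In particular the `q` far vertices through a child are all in the root region or all off it: the region-direction count of a region vertex is the number of its children whose
line is a residual eigenline of `Ȳ`. [cite: Kottwitz1986, §3] [cite: BruhatTits1972, §10] [cite: Tits1979, §3.5] -/
theorem map_sub_one_far_le_scaleLattice_iff_eigenline_of_odd (hvσ : ∀ a, Valued.v (σ a) = Valued.v a) (hσϖ : σ ϖ = -ϖ)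
    (hϖ : Valued.v ϖ = WithZero.exp (-1 : ℤ)) (hres : ∀ x : K, Valued.v x ≤ 1 → Valued.v (σ x - x) < 1) (h2 : Valued.v (2 : K) = 1) [Finite 𝓀[K]]
    {γ : unitaryGroupOfForm σ ((StdForm.antidiagonal 3).over K)} {d₀ : ℕ} (hodd : Odd d₀)
    (u : unitaryGroupOfForm σ ((StdForm.antidiagonal 3).over K)) {v : {M : Submodule 𝒪[K] (Fin 3 → K) // IsVertex σ ϖ ((StdForm.antidiagonal 3).over K) M}} (hvu : v = latticeGraphIso σ ϖ ((StdForm.antidiagonal 3).over K) u ⟨stdLattice K 3, 0, isSelfDualLattice_stdLattice_three_of_v hϖ⟩)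
    (hvR : v.1.map ((Matrix.toLin' (((γ : GL (Fin 3) K) : Matrix (Fin 3) (Fin 3) K) - 1)).restrictScalars 𝒪[K]) ≤ scaleLattice (ϖ ^ d₀) v.1)
    (κ : unitaryGroupOfForm σ ((StdForm.antidiagonal 3).over K)) (hκ : κ ∈ unitaryInt σ ((StdForm.antidiagonal 3).over K))
    {w : {M : Submodule 𝒪[K] (Fin 3 → K) // IsVertex σ ϖ ((StdForm.antidiagonal 3).over K) M}} (hwv : w ≠ v)
    (hcw : (latticeGraph σ ϖ ((StdForm.antidiagonal 3).over K)).Adj (latticeGraphIso σ ϖ ((StdForm.antidiagonal 3).over K) (u * κ) ⟨latt (Matrix.diagonal ![(1 : K), 1, ϖ]), 2, isVertexLattice_two_N₁_of_neg hσϖ hϖ⟩) w) :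
    w.1.map ((Matrix.toLin' (((γ : GL (Fin 3) K) : Matrix (Fin 3) (Fin 3) K) - 1)).restrictScalars 𝒪[K]) ≤ scaleLattice (ϖ ^ d₀) w.1 ↔
      Valued.v (((((((u * κ : unitaryGroupOfForm σ ((StdForm.antidiagonal 3).over K)) : GL (Fin 3) K))⁻¹ : GL (Fin 3) K) : Matrix (Fin 3) (Fin 3) K) *
          (((γ : GL (Fin 3) K) : Matrix (Fin 3) (Fin 3) K) - 1) * (((u * κ : unitaryGroupOfForm σ ((StdForm.antidiagonal 3).over K)) : GL (Fin 3) K) : Matrix (Fin 3) (Fin 3) K)) 1 0) ≤ Valued.v ϖ ^ (d₀ + 1) ∧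
      Valued.v (((((((u * κ : unitaryGroupOfForm σ ((StdForm.antidiagonal 3).over K)) : GL (Fin 3) K))⁻¹ : GL (Fin 3) K) : Matrix (Fin 3) (Fin 3) K) *
          (((γ : GL (Fin 3) K) : Matrix (Fin 3) (Fin 3) K) - 1) * (((u * κ : unitaryGroupOfForm σ ((StdForm.antidiagonal 3).over K)) : GL (Fin 3) K) : Matrix (Fin 3) (Fin 3) K)) 2 0) ≤ Valued.v ϖ ^ (d₀ + 1) := by
  have hϖ0 : ϖ ≠ 0 := fun h0 => by rw [h0, map_zero] at hϖ; exact WithZero.coe_ne_zero hϖ.symm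
  -- STEP A — the frame of the far vertex: `w = latt((uκ)·g(a,b))`, `|a| = 1`, `|b| ≤ 1` (★ D pulled back along `uκ`, as in §2)
  obtain ⟨a, b, ha, hb, hw1⟩ : ∃ a b : K, Valued.v a = 1 ∧ Valued.v b ≤ 1 ∧
      w.1 = latt ((((u * κ : unitaryGroupOfForm σ ((StdForm.antidiagonal 3).over K)) : GL (Fin 3) K) : Matrix (Fin 3) (Fin 3) K) * !![a / ϖ, 0, 0; 0, 1, 0; b, 0, ϖ]) := by
    set w' := latticeGraphIso σ ϖ ((StdForm.antidiagonal 3).over K) (u * κ)⁻¹ w with hw'def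
    have hww' : latticeGraphIso σ ϖ ((StdForm.antidiagonal 3).over K) (u * κ) w' = w := latticeGraphIso_mul_inv_apply _ _
    have hw' : w' ∈ (latticeGraph σ ϖ ((StdForm.antidiagonal 3).over K)).neighborSet ⟨latt (Matrix.diagonal ![(1 : K), 1, ϖ]), 2, isVertexLattice_two_N₁_of_neg hσϖ hϖ⟩ := by
      rw [SimpleGraph.mem_neighborSet]
      rw [← hww'] at hcw
      exact (latticeGraphIso σ ϖ ((StdForm.antidiagonal 3).over K) (u * κ)).map_adj_iff.1 hcw
    have hne' : w'.1 ≠ stdLattice K 3 := by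
      intro h
      apply hwv
      have hroot : w' = ⟨stdLattice K 3, 0, isSelfDualLattice_stdLattice_three_of_v hϖ⟩ := Subtype.ext h
      rw [← hww', hroot, latticeGraphIso_mul_apply, latticeGraphIso_root_eq_of_mem_unitaryInt hϖ hκ, ← hvu]
    obtain ⟨a, b, ha, hb, hw'1⟩ := exists_unit_vec_of_mem_neighborSet_N₁_of_ne_stdLattice hvσ hσϖ hϖ hres hw' hne'
    refine ⟨a, b, ha, hb, ?_⟩
    rw [← hww', latticeGraphIso_apply_val, hw'1, latt_coe_mul_childFrame_eq hϖ _ ha hb]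
  -- STEP B — the conjugate `(uκ)⁻¹(γ−1)(uκ)` has level `ϖ^{d₀}`: `v = latt u` is a region vertex and `κ ∈ K₀`
  have hv1 : v.1 = latt ((u : GL (Fin 3) K) : Matrix (Fin 3) (Fin 3) K) := by rw [hvu, latticeGraphIso_apply_val]; rfl
  have hY : ∀ i k, Valued.v (((((u : GL (Fin 3) K)⁻¹ : GL (Fin 3) K) : Matrix (Fin 3) (Fin 3) K) * (((γ : GL (Fin 3) K) : Matrix (Fin 3) (Fin 3) K) - 1) *
      ((u : GL (Fin 3) K) : Matrix (Fin 3) (Fin 3) K)) i k) ≤ Valued.v ϖ ^ d₀ := by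
    have h := hvR
    rw [hv1, map_toLin'_latt_le_scaleLattice_iff (pow_ne_zero _ hϖ0) _ (Matrix.isUnits_det_units _), map_pow, ← Matrix.coe_units_inv] at h
    exact h
  have hκi := (mem_unitaryInt_iff.1 hκ).1
  have hκi' := (mem_unitaryInt_iff.1 hκ).2
  have hMeq : (((((u * κ : unitaryGroupOfForm σ ((StdForm.antidiagonal 3).over K)) : GL (Fin 3) K))⁻¹ : GL (Fin 3) K) : Matrix (Fin 3) (Fin 3) K) *
      (((γ : GL (Fin 3) K) : Matrix (Fin 3) (Fin 3) K) - 1) * (((u * κ : unitaryGroupOfForm σ ((StdForm.antidiagonal 3).over K)) : GL (Fin 3) K) : Matrix (Fin 3) (Fin 3) K) =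
      (((κ : GL (Fin 3) K)⁻¹ : GL (Fin 3) K) : Matrix (Fin 3) (Fin 3) K) *
      ((((u : GL (Fin 3) K)⁻¹ : GL (Fin 3) K) : Matrix (Fin 3) (Fin 3) K) * (((γ : GL (Fin 3) K) : Matrix (Fin 3) (Fin 3) K) - 1) * ((u : GL (Fin 3) K) : Matrix (Fin 3) (Fin 3) K)) *
      ((κ : GL (Fin 3) K) : Matrix (Fin 3) (Fin 3) K) := by
    rw [Subgroup.coe_mul, mul_inv_rev, Units.val_mul, Units.val_mul]
    simp only [Matrix.mul_assoc]
  have hM : ∀ i k, Valued.v ((((((((u * κ : unitaryGroupOfForm σ ((StdForm.antidiagonal 3).over K)) : GL (Fin 3) K))⁻¹ : GL (Fin 3) K) : Matrix (Fin 3) (Fin 3) K) *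
      (((γ : GL (Fin 3) K) : Matrix (Fin 3) (Fin 3) K) - 1) * (((u * κ : unitaryGroupOfForm σ ((StdForm.antidiagonal 3).over K)) : GL (Fin 3) K) : Matrix (Fin 3) (Fin 3) K))) i k) ≤ Valued.v ϖ ^ d₀ := by
    intro i k; rw [hMeq]; exact v_mul_mul_apply_le_of_le hκi' hY hκi i k
  -- STEP C — §1 on the frame
  have key := map_sub_one_childLatt_le_scaleLattice_iff_eigenline_of_odd hvσ hσϖ hϖ hres h2 (u * κ) γ ha hb hodd hM
  rw [hw1]
  exact key

end Literature.NumberTheory.Automorphic.UnitaryLatticeTree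

end
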